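import Summits.QuantumFields.YangMills.Theorems.AllWindowsColdBoxBoxHighLineQuarticL2
import Summits.QuantumFields.YangMills.Theorems.AllWindowsColdBoxBoxHighLineWilsonPlaquetteTaylor
import Summits.QuantumFields.YangMills.Theorems.AllWindowsColdBoxBoxHighLineQuadFormFluct
import Summits.QuantumFields.YangMills.Theorems.AllWindowsColdBoxBoxHighLineHaarTaylor
import Summits.QuantumFields.YangMills.Theorems.AllWindowsColdBoxBoxHighLineStep2Tilt
import Summits.QuantumFields.YangMills.Theorems.AllWindowsColdBoxBoxHighLineGaussCovMainReduction
import Summits.QuantumFields.YangMills.Theorems.AllWindowsColdBoxBoxHighLineSmallFieldInsideFPCore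

/-!
# T-S5.13K-U, PRELIMINARIES — for the `L²(1_D·Gaussian)` size of the even part of the tilt exponent (main file `…TiltUEvenL2.lean`)
# (ASSEMBLY-S5 §6 (g4)/(g5)/(g7); LINE-19 S5 ⟨stmt-QuantumFields-24004⟩)

The tilt exponent of ✓`…Step2Tilt` is `tiltU β H = −cubicVertex − quarticWilson − β(Φ(U ·) − divLinSq) + ghostLogRatio + haarLogRatio`; its even part
`U + V₃ = −W₄ − U_Φ + ghostLogRatio + haarLogRatio` is, on the small-field box `D = smallField H s` (`0 ≤ s ≤ 1`, `s·H² ≤ c₀`), a centred `L²(E₀)`-small quantity: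
with `b := E₀[quadVal M_H] + E₀[quadVal (−(1/3)·1)]` (`M_H` the ghost quadratic form of T-S5.7d),

  `E₀[1_D · (tiltU β H + cubicVertex β H − b)²] ≤ C·(1 + log H)^m·(H⁸/β² + H¹²·s⁶ + H⁸·s⁸)`   (`H ≥ 1`, `β ≥ H⁴`).

Pointwise on `D`: `(U+V₃−b)² ≤ 6·(W₄² + U_Φ² + (quadVal M_H − E₀)² + (C_g H⁶(1+log H)^m s³)² + (quadVal(−I/3) − E₀)² + (C_h·n·s⁴)²)`, and `W₄²`, `U_Φ²` are further dominated
by the polynomial majorants of ✓12c (`QuarticL2Proof.quarticWilson_sq_le` with ✓7a `wilsonPlaquetteTaylor`, `QuarticL2Proof.phi_sq_le` with ✓7b) — so the whole bound is ONE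
integrable majorant and `gaussAvg_mono` (no measurability of `tiltU` needed).  Expectations: ✓12c's `gaussAvg_wilson_majorant_le` / `gaussAvg_phi_majorant_le` (`H⁸/β²`),
✓12b `quadFormFluct` twice (`Var₀(a·Ma) ≤ C_b(H⁴/β²)ΣM²`, with `ΣM_H² ≤ C_g H⁴(1+log H)^m` from 7d and `Σ(I/3)² = n/3`, `n = 3|LandauFree H| ≤ 648H⁴`), ✓7c `haarTaylor`
(`|log(σ(r)/σ(0)) + r²/3| ≤ C_h r⁴`), and T-S5.7d `GhostTaylor` as a HYPOTHESIS VERBATIM (w3's task; nothing of it restated).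

THIS FILE (preliminaries): §1 `polyDeg_quadForm`, `integrable_quadVal_sub_pow_mul_gaussWeight`; §2 `gaussAvg_sub_avg_sq_eq_gaussCov` (`E₀[(F − E₀F)²] = Cov₀(F,F)`),
  ★`gaussAvg_quadVal_centred_sq_le` (12b, centred form); §3 `flat_dotProduct_flat`, `quadVal_smul_one`, `sum_sq_smul_one`, `abs_haarLogRatio_sub_quadVal_le` (7c);
  §4 `sq_six_decomp_le` (the pointwise six-term domination), `tiltU_add_cubicVertex`.  The main theorem is in `…TiltUEvenL2.lean`.

Mathlib + tree; no definitions.  HONEST LABEL: a support brick of the (e4)/(e5) sizes of the T-S5.13 assembly of the XL stub S5 of a critic-PASSed DRAFT line, conditional on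
T-S5.7d; S5, U5, ⟨24004⟩ ⟨24335⟩ ⟨24336⟩ remain OPEN; route AllWindowsColdBox is DRAFT; no rung is proved; **the Yang–Mills mass gap is NOT proved by this file; no summit is
proved by a line.**  Seat ym-line-fcl-p3 g26 (cell ym-idea-1).
-/

set_option autoImplicit false

noncomputable section

open MeasureTheory Matrix Finset
open scoped Kronecker
open Literature.Probability.LatticeModels (Site)
open Literature.MathematicalPhysics.QuantumLattice (plaquettesTouching)
open Literature.MathematicalPhysics.QuantumFieldTheory.AxialGauge (boxEdges)
open Literature.MathematicalPhysics.QuantumFieldTheory.Balaban1983to89.B10Eq22Rescaling (sigmaSU2)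

namespace Summit.QuantumFields.YangMills.Theorems.AllWindowsColdBoxBoxHighLine

namespace GaussNormalForm

open Hypercontractivity (polyDeg_const polyDeg_coord polyDeg_sub polyDeg_mul polyDeg_pow polyDeg_sum polyDeg_mulVec)
open EdgeChartGaussian (integrable_gaussWeight gaussAvg_mono_of_nonneg gaussAvg_nonneg gaussAvg_const_fun)
open LaplaceSandwich (flatten)

variable {H : ℕ} {β : ℝ}

/-! ## §1 Polynomial certificate and integrability of the quadratic forms -/

/-- A quadratic form `v ↦ v ⬝ (M v)` is a certified polynomial of degree `≤ 2` in the flat chart variable. -/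
theorem polyDeg_quadForm {ι : Type*} [Fintype ι] (M : Matrix ι ι ℝ) :
    ∃ Q : MvPolynomial ι ℝ, Q.totalDegree ≤ 2 ∧ ∀ v : ι → ℝ, v ⬝ᵥ (M *ᵥ v) = MvPolynomial.eval v Q := by
  refine polyDeg_sum Finset.univ (F := fun i v => v i * (M *ᵥ v) i) fun i _ => ?_
  exact polyDeg_mul (polyDeg_coord i le_rfl) (polyDeg_mulVec M i le_rfl)

/-- `(quadVal M a − c)^k · gaussWeight` is integrable (`β > 0`). -/
theorem integrable_quadVal_sub_pow_mul_gaussWeight (hβ : 0 < β) (M : Matrix (LandauFree H × Fin 3) (LandauFree H × Fin 3) ℝ) (c : ℝ) (k : ℕ) :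
    Integrable (fun a : LandauFree H → E3 => (quadVal M a - c) ^ k * gaussWeight β H a) :=
  PlaqObsL2.integrable_polyFlat_mul_gaussWeight H hβ (G := fun v => (v ⬝ᵥ (M *ᵥ v) - c) ^ k)
    (polyDeg_pow (polyDeg_sub (polyDeg_quadForm M) (polyDeg_const c 2)) k) fun a => by rw [QuadFluct.quadVal_eq_flat]

/-! ## §2 The centred fluctuation of a quadratic form (12b) -/

/-- `E₀[(F − E₀F)²] = Cov₀(F, F)` for `F`, `F²` integrable against the weight. -/
theorem gaussAvg_sub_avg_sq_eq_gaussCov (hβ : 0 < β) {F : (LandauFree H → E3) → ℝ} (h1 : Integrable (fun a => F a * gaussWeight β H a))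
    (h2 : Integrable (fun a => F a * F a * gaussWeight β H a)) :
    gaussAvg β H (fun a => (F a - gaussAvg β H F) ^ 2) = gaussCov β H F F := by
  set c := gaussAvg β H F with hc
  have e : (fun a => (F a - c) ^ 2) = fun a => F a * F a + (-2 * c * F a + c ^ 2) := by
    funext a; ring
  have hlin : Integrable (fun a => -2 * c * F a * gaussWeight β H a) := (h1.const_mul (-2 * c)).congr (Filter.Eventually.of_forall fun a => by ring)
  have hconst : Integrable (fun a => c ^ 2 * gaussWeight β H a) := (integrable_gaussWeight H hβ).const_mul _
  have hrest : Integrable (fun a => (-2 * c * F a + c ^ 2) * gaussWeight β H a) :=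
    (hlin.add hconst).congr (Filter.Eventually.of_forall fun a => by simp only [Pi.add_apply]; ring)
  rw [e, EdgeChartGaussian.gaussAvg_add β H h2 hrest, EdgeChartGaussian.gaussAvg_add β H hlin hconst, EdgeChartGaussian.gaussAvg_const_mul,
    gaussAvg_const_fun H hβ, gaussCov]
  ring

/-- ★ **12b in centred form**: `E₀[(quadVal M − E₀ quadVal M)²] ≤ C_b·(H⁴/β²)·Σ M²` with `C_b ≥ 0` (✓`quadFormFluct`). -/
theorem gaussAvg_quadVal_centred_sq_le : ∃ C : ℝ, 0 ≤ C ∧ ∀ H : ℕ, 1 ≤ H → ∀ β : ℝ, 0 < β →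
    ∀ M : Matrix (LandauFree H × Fin 3) (LandauFree H × Fin 3) ℝ,
      gaussAvg β H (fun a => (quadVal M a - gaussAvg β H (quadVal M)) ^ 2) ≤ C * ((H : ℝ) ^ 4 / β ^ 2) * ∑ i, ∑ j, M i j ^ 2 := by
  obtain ⟨C, hC⟩ := quadFormFluct
  refine ⟨max C 0, le_max_right _ _, fun H hH β hβ M => ?_⟩
  have h1 : Integrable (fun a => quadVal M a * gaussWeight β H a) :=
    (integrable_quadVal_sub_pow_mul_gaussWeight hβ M 0 1).congr (Filter.Eventually.of_forall fun a => by ring)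
  have h2 : Integrable (fun a => quadVal M a * quadVal M a * gaussWeight β H a) :=
    (integrable_quadVal_sub_pow_mul_gaussWeight hβ M 0 2).congr (Filter.Eventually.of_forall fun a => by ring)
  rw [gaussAvg_sub_avg_sq_eq_gaussCov hβ h1 h2]
  refine (hC H hH β hβ M).trans ?_
  have hS : 0 ≤ ∑ i, ∑ j, M i j ^ 2 := Finset.sum_nonneg fun i _ => Finset.sum_nonneg fun j _ => sq_nonneg _
  exact mul_le_mul_of_nonneg_right (mul_le_mul_of_nonneg_right (le_max_left _ _) (by positivity)) hS

/-! ## §3 The Haar piece: `haarLogRatio = quadVal(−I/3) + O(n·s⁴)` on `D` -/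

/-- `♭a ⬝ ♭a = Σ_e ‖a_e‖²`. -/
theorem flat_dotProduct_flat (a : LandauFree H → E3) : flat a ⬝ᵥ flat a = ∑ e : LandauFree H, ‖a e‖ ^ 2 := by
  calc flat a ⬝ᵥ flat a = ∑ i, flat a i ^ 2 := by simp only [dotProduct, sq]
    _ = ∑ e, ‖a e‖ ^ 2 := by
        rw [Fintype.sum_prod_type]
        refine Finset.sum_congr rfl fun e _ => ?_
        rw [BoxQuadForm.norm_sq_eq_sum]
        rfl

/-- `quadVal (c·1) a = c · Σ_e ‖a_e‖²`. -/
theorem quadVal_smul_one (c : ℝ) (a : LandauFree H → E3) :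
    quadVal (c • (1 : Matrix (LandauFree H × Fin 3) (LandauFree H × Fin 3) ℝ)) a = c * ∑ e : LandauFree H, ‖a e‖ ^ 2 := by
  unfold quadVal
  rw [Matrix.smul_mulVec, Matrix.one_mulVec, dotProduct_smul, smul_eq_mul, flat_dotProduct_flat]

/-- `Σ_{ij} ((c·1)_{ij})² = |LandauFree H × Fin 3| · c²`. -/
theorem sum_sq_smul_one (c : ℝ) :
    ∑ i : LandauFree H × Fin 3, ∑ j : LandauFree H × Fin 3, (c • (1 : Matrix (LandauFree H × Fin 3) (LandauFree H × Fin 3) ℝ)) i j ^ 2 =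
      Fintype.card (LandauFree H × Fin 3) * c ^ 2 := by
  have h : ∀ i : LandauFree H × Fin 3, ∑ j : LandauFree H × Fin 3, (c • (1 : Matrix (LandauFree H × Fin 3) (LandauFree H × Fin 3) ℝ)) i j ^ 2 = c ^ 2 := by
    intro i
    simp only [Matrix.smul_apply, Matrix.one_apply, smul_eq_mul, mul_ite, mul_one, mul_zero]
    rw [Finset.sum_eq_single i (fun j _ hj => by rw [if_neg (Ne.symm hj)]; ring) (fun h => absurd (Finset.mem_univ i) h), if_pos rfl]
  simp only [h, Finset.sum_const, Finset.card_univ, nsmul_eq_mul]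

/-- **Haar remainder on `D`** (✓7c): for `a ∈ smallField H s`, `0 ≤ s ≤ 1`,
`|haarLogRatio H a − quadVal (−(1/3)·1) a| ≤ C_h · |LandauFree H| · s⁴` (`C_h ≥ 0` the constant of `haarTaylor`). -/
theorem abs_haarLogRatio_sub_quadVal_le : ∃ C : ℝ, 0 ≤ C ∧ ∀ (H : ℕ) (s : ℝ), 0 ≤ s → s ≤ 1 → ∀ a ∈ smallField H s,
    |haarLogRatio H a - quadVal ((-(1 / 3 : ℝ)) • (1 : Matrix (LandauFree H × Fin 3) (LandauFree H × Fin 3) ℝ)) a| ≤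
      C * (Fintype.card (LandauFree H) : ℝ) * s ^ 4 := by
  obtain ⟨C, hC⟩ := haarTaylor
  have hC0 : 0 ≤ C := by
    have h := hC 1 zero_le_one le_rfl
    have : (0 : ℝ) ≤ C * 1 ^ 4 := (abs_nonneg _).trans h
    linarith
  refine ⟨C, hC0, fun H s hs0 hs1 a ha => ?_⟩
  rw [quadVal_smul_one, haarLogRatio]
  have e : ∑ e : LandauFree H, Real.log (sigmaSU2 ‖a e‖ / sigmaSU2 0) - -(1 / 3) * ∑ e : LandauFree H, ‖a e‖ ^ 2 =
      ∑ e : LandauFree H, (Real.log (sigmaSU2 ‖a e‖ / sigmaSU2 0) + ‖a e‖ ^ 2 / 3) := by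
    rw [Finset.sum_add_distrib, ← Finset.sum_div]; ring
  rw [e]
  calc |∑ e : LandauFree H, (Real.log (sigmaSU2 ‖a e‖ / sigmaSU2 0) + ‖a e‖ ^ 2 / 3)|
      ≤ ∑ e : LandauFree H, |Real.log (sigmaSU2 ‖a e‖ / sigmaSU2 0) + ‖a e‖ ^ 2 / 3| := Finset.abs_sum_le_sum_abs _ _
    _ ≤ ∑ _e : LandauFree H, C * s ^ 4 := by
        refine Finset.sum_le_sum fun e _ => (hC ‖a e‖ (norm_nonneg _) ((ha e).trans hs1)).trans ?_
        exact mul_le_mul_of_nonneg_left (pow_le_pow_left₀ (norm_nonneg _) (ha e) 4) hC0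
    _ = C * (Fintype.card (LandauFree H) : ℝ) * s ^ 4 := by rw [Finset.sum_const, Finset.card_univ, nsmul_eq_mul]; ring

/-! ## §4 The size of the even part of the tilt exponent on `D` -/

/-- The algebraic identity behind the decomposition: `tiltU + cubicVertex = −W₄ − U_Φ + ghost + haar`. -/
theorem tiltU_add_cubicVertex (β : ℝ) (H : ℕ) (a : LandauFree H → E3) :
    tiltU β H a + cubicVertex β H a = -quarticWilson β H a - β * (landauPhi H (edgeChart H a) - divLinSq H a) + ghostLogRatio H a + haarLogRatio H a := by
  unfold tiltU; ring

/-- **The pointwise six-term domination** (pure algebra): if `w² ≤ m_W`, `φ² ≤ m_Φ`, `|g − q_M| ≤ K₁`, `|h − q_h| ≤ K₂` then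
`(−w − φ + g + h − (c_M + c_h))² ≤ 6·(m_W + m_Φ + (q_M − c_M)² + K₁² + (q_h − c_h)² + K₂²)`. -/
theorem sq_six_decomp_le {w φ g h qM qh cM ch K₁ K₂ mW mΦ : ℝ} (hw : w ^ 2 ≤ mW) (hφ : φ ^ 2 ≤ mΦ) (hg : |g - qM| ≤ K₁) (hh : |h - qh| ≤ K₂) :
    (-w - φ + g + h - (cM + ch)) ^ 2 ≤ 6 * (mW + mΦ + (qM - cM) ^ 2 + K₁ ^ 2 + (qh - ch) ^ 2 + K₂ ^ 2) := by
  have e : -w - φ + g + h - (cM + ch) = (-w) + (-φ) + (qM - cM) + (g - qM) + (qh - ch) + (h - qh) := by ring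
  rw [e]
  -- six-term Cauchy–Schwarz (inlined; the tree's `Literature.Geometry.Riemannian.HamiltonODE.sq_sum6_le` is the same inequality)
  have h6cs : ∀ x₁ x₂ x₃ x₄ x₅ x₆ : ℝ, (x₁ + x₂ + x₃ + x₄ + x₅ + x₆) ^ 2 ≤ 6 * (x₁ ^ 2 + x₂ ^ 2 + x₃ ^ 2 + x₄ ^ 2 + x₅ ^ 2 + x₆ ^ 2) := by
    intro x₁ x₂ x₃ x₄ x₅ x₆
    nlinarith [sq_nonneg (x₁ - x₂), sq_nonneg (x₁ - x₃), sq_nonneg (x₁ - x₄), sq_nonneg (x₁ - x₅), sq_nonneg (x₁ - x₆), sq_nonneg (x₂ - x₃),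
      sq_nonneg (x₂ - x₄), sq_nonneg (x₂ - x₅), sq_nonneg (x₂ - x₆), sq_nonneg (x₃ - x₄), sq_nonneg (x₃ - x₅), sq_nonneg (x₃ - x₆),
      sq_nonneg (x₄ - x₅), sq_nonneg (x₄ - x₆), sq_nonneg (x₅ - x₆)]
  refine (h6cs _ _ _ _ _ _).trans ?_
  have h1 : (-w) ^ 2 = w ^ 2 := neg_sq w
  have h2 : (-φ) ^ 2 = φ ^ 2 := neg_sq φ
  have h4 : (g - qM) ^ 2 ≤ K₁ ^ 2 := by rw [← sq_abs]; exact pow_le_pow_left₀ (abs_nonneg _) hg 2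
  have h6 : (h - qh) ^ 2 ≤ K₂ ^ 2 := by rw [← sq_abs]; exact pow_le_pow_left₀ (abs_nonneg _) hh 2
  linarith

end GaussNormalForm

end Summit.QuantumFields.YangMills.Theorems.AllWindowsColdBoxBoxHighLine

end
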